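import Mathlib.Analysis.Normed.Algebra.MatrixExponential
import Mathlib.Analysis.SpecialFunctions.Exponential
import Literature.NumberTheory.Automorphic.AdelicGLnGlue
import Literature.NumberTheory.Automorphic.ArchimedeanGLn
import Literature.NumberTheory.Automorphic.ClassFieldCharacter
import Literature.NumberTheory.GaloisRepresentations.ArchimedeanHerbrand
import HarnessLib

/-!
# Archimedean exponential ideles of `GL₁`: coordinates, Galois action and base change

Topic `NumberTheory/Automorphic`; proof file (theorems only: no definition, no named fact, no
instance), seventh step of the rank-one case of the named fact
`ArthurClozel1989_strongLifting_archimedean` (`BaseChangeArchimedean`; Arthur–Clozel (1989),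
Ch. 3, Thm. 5.1 with Ch. 1 §7: at the archimedean places base change for `GL(1)` is
`χ_v ↦ χ_v ∘ N_{E_w/F_v}`, "restriction on the Weil group side").

For `Y ∈ 𝔤𝔩₁(K_∞) = Matrix (Fin 1) (Fin 1) (mixedSpace K)` write
`γ_K(Y) = det (exp Y, 1) ∈ 𝕀_K` (`GLn.ofInfinite 1 K (expGL Y)`; this is the idele
`det (ofArch (expMem Y))` of the `GL₁` datum, along which the Hecke character of an automorphic
representation of `GL₁(𝔸_K)` is `e^{d(Y)}`, `AutomorphicRepsGLOneHeckeCharacter`). This file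
computes these ideles in the coordinates `w ↦ extensionEmbedding w (y_w) ∈ ℂ` of `K_∞`:

* `extensionEmbedding_det_ofInfinite_expGL_of_isComplex/…_of_isReal` — `γ_K(Y)` is `1` at the
  finite places and `e^{Y_w}` at the infinite place `w` (`Y_w ∈ ℝ` or `ℂ` the coordinate of the
  entry of `Y`); `idele_eq_of_snd_eq_of_extensionEmbedding_eq` — such ideles are determined by their
  coordinates.
* **Galois action** (`E/F`, `σ ∈ Gal(E/F)` acting on `𝕀_E`, `GaloisActionAdeleRing`,
  `(σ • y)_w = σ_{σ⁻¹w}(y_{σ⁻¹ w})`): `smul_det_ofInfinite_expGL_realPlace` —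
  `σ • γ_E(r · 1_w) = γ_E(r · 1_{σ w})` at a real place; `smul_det_ofInfinite_expGL_complexPlace` —
  `σ • γ_E(a_w) = γ_E(a'_{σ w})` with `a' ∈ {a, ā}` at a complex place, and
  `smul_det_ofInfinite_expGL_complexPlace_of_ne_one` — `c • γ_E(a_w) = γ_E(ā_w)` for `c ≠ 1` in
  the decomposition group of `w` (which acts on `E_w = ℂ` by conjugation,
  `extensionEmbedding_galInfiniteCompletionMap_of_ne_one`).
* **Base change** (`ideleBaseChange F E`, componentwise `F_v → E_w`, `AdeleBaseChange`):
  `ideleBaseChange_det_ofInfinite_expGL_realPlace` — `(γ_F(r · 1_v))_E = γ_E(y · 1)` with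
  `y_w = r` at every `w ∣ v` and `0` elsewhere; `ideleBaseChange_det_ofInfinite_expGL_complexPlace`
  — `(γ_F(b_v))_E = γ_E(y · 1)` with `y_w = b` or `b̄` at `w ∣ v` according as `σ_w|_F = σ_v` or
  `σ̄_v`, and `0` elsewhere.

These are the idelic identities behind `Θ_{Π_w} = Θ_{π_v} ∘ N_{E_w/F_v}` for `GL(1)`
(Arthur–Clozel, Ch. 1 §7; Tate (1967), Ch. VII §1.1) as used in the sequel file.

## References

* J. Arthur, L. Clozel, Ann. of Math. Stud. 120 (1989), Ch. 1 §7, Ch. 3 Thm. 5.1 [ArthurClozelAMS120].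
* J. W. S. Cassels, A. Fröhlich (eds.), *Algebraic Number Theory* (1967), Ch. VII (Tate) §1.1,
  Ch. II (Cassels) §14 [CasselsFrohlichANT1967].
-/

noncomputable section

open scoped MatrixGroups Matrix Classical ComplexConjugate
open NumberField NumberField.InfinitePlace NumberField.mixedEmbedding IsDedekindDomain NormedSpace

namespace Literature.NumberTheory.Automorphic

open Literature.NumberTheory.GaloisRepresentations

/-! ### Coordinates of `det (exp Y, 1)` -/

section Coordinates

variable (K : Type) [Field K] [NumberField K]

/-- The entry of the exponential of a `1 × 1` matrix over `K_∞` is the exponential of its entry.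
[folklore] -/
theorem expGL_fin_one_apply (Y : Matrix (Fin 1) (Fin 1) (mixedSpace K)) :
    ((expGL Y : GL (Fin 1) (mixedSpace K)) : Matrix (Fin 1) (Fin 1) (mixedSpace K)) 0 0 =
      exp (Y 0 0) := by
  have hY : Y = Matrix.diagonal fun _ => Y 0 0 := Matrix.ext fun i j => by
    rw [Subsingleton.elim i 0, Subsingleton.elim j 0, Matrix.diagonal_apply_eq]
  rw [coe_expGL]
  change (exp Y) 0 0 = _
  conv_lhs => rw [hY]
  rw [Matrix.exp_diagonal, Matrix.diagonal_apply_eq, Pi.coe_exp]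

/-- The archimedean component of `det (g, 1)` for `g ∈ GL₁(K_∞)` is the entry of `g` (read in
`K_∞` through `ringEquiv_mixedSpace`). [folklore] -/
theorem ringEquiv_det_ofInfinite_fst (g : GL (Fin 1) (mixedSpace K)) :
    InfiniteAdeleRing.ringEquiv_mixedSpace K
      (((Matrix.GeneralLinearGroup.det (GLn.ofInfinite 1 K g) : (AdeleRing (𝓞 K) K)ˣ) :
        AdeleRing (𝓞 K) K).1) = (g : Matrix (Fin 1) (Fin 1) (mixedSpace K)) 0 0 := by
  rw [Matrix.GeneralLinearGroup.val_det_apply, Matrix.det_fin_one, GLn.coe_ofInfinite_apply]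
  exact RingEquiv.apply_symm_apply _ _

/-- The finite component of `det (g, 1)` for `g ∈ GL₁(K_∞)` is `1`. [folklore] -/
theorem det_ofInfinite_snd (g : GL (Fin 1) (mixedSpace K)) :
    (((Matrix.GeneralLinearGroup.det (GLn.ofInfinite 1 K g) : (AdeleRing (𝓞 K) K)ˣ) :
        AdeleRing (𝓞 K) K).2) = 1 := by
  rw [Matrix.GeneralLinearGroup.val_det_apply, Matrix.det_fin_one, GLn.coe_ofInfinite_apply]
  exact Matrix.one_apply_eq 0

omit [NumberField K] in
/-- The complex coordinate at a complex place `w` of an infinite adele is its `w`-component read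
through `ringEquiv_mixedSpace` (definitional). [folklore] -/
theorem extensionEmbedding_apply_eq_ringEquiv_snd (y : InfiniteAdeleRing K)
    (w : {w : InfinitePlace K // w.IsComplex}) :
    Completion.extensionEmbedding w.1 (y w.1) = (InfiniteAdeleRing.ringEquiv_mixedSpace K y).2 w :=
  rfl

omit [NumberField K] in
/-- The complex coordinate at a real place `w` of an infinite adele is its (real) `w`-component
read through `ringEquiv_mixedSpace`. [folklore] -/
theorem extensionEmbedding_apply_eq_ringEquiv_fst (y : InfiniteAdeleRing K)
    (w : {w : InfinitePlace K // w.IsReal}) :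
    Completion.extensionEmbedding w.1 (y w.1) =
      ((InfiniteAdeleRing.ringEquiv_mixedSpace K y).1 w : ℂ) := by
  rw [InfiniteAdeleRing.ringEquiv_mixedSpace_apply]
  exact (Completion.extensionEmbeddingOfIsReal_apply w.2 _).symm

/-- **Coordinates of `det (exp Y, 1)` at a complex place**: `e^{Y_w}`. [folklore] -/
theorem extensionEmbedding_det_ofInfinite_expGL_of_isComplex (Y : Matrix (Fin 1) (Fin 1) (mixedSpace K))
    (w : {w : InfinitePlace K // w.IsComplex}) :
    Completion.extensionEmbedding w.1
      ((((Matrix.GeneralLinearGroup.det (GLn.ofInfinite 1 K (expGL Y)) : (AdeleRing (𝓞 K) K)ˣ) :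
        AdeleRing (𝓞 K) K).1) w.1) = Complex.exp ((Y 0 0).2 w) := by
  rw [extensionEmbedding_apply_eq_ringEquiv_snd, ringEquiv_det_ofInfinite_fst, expGL_fin_one_apply,
    Prod.snd_exp, Pi.coe_exp, Complex.exp_eq_exp_ℂ]

/-- **Coordinates of `det (exp Y, 1)` at a real place**: `e^{Y_w}`. [folklore] -/
theorem extensionEmbedding_det_ofInfinite_expGL_of_isReal (Y : Matrix (Fin 1) (Fin 1) (mixedSpace K))
    (w : {w : InfinitePlace K // w.IsReal}) :
    Completion.extensionEmbedding w.1
      ((((Matrix.GeneralLinearGroup.det (GLn.ofInfinite 1 K (expGL Y)) : (AdeleRing (𝓞 K) K)ˣ) :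
        AdeleRing (𝓞 K) K).1) w.1) = ((Real.exp ((Y 0 0).1 w) : ℝ) : ℂ) := by
  rw [extensionEmbedding_apply_eq_ringEquiv_fst, ringEquiv_det_ofInfinite_fst, expGL_fin_one_apply,
    Prod.fst_exp, Pi.coe_exp, Real.exp_eq_exp_ℝ]

/-- The complex coordinate of `det (exp Y, 1)` at any infinite place `w`, as a function of the
place: `e^{Y_w}` (real places read through `ℝ ⊂ ℂ`). [folklore] -/
theorem extensionEmbedding_det_ofInfinite_expGL (Y : Matrix (Fin 1) (Fin 1) (mixedSpace K))
    (w : InfinitePlace K) :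
    Completion.extensionEmbedding w
      ((((Matrix.GeneralLinearGroup.det (GLn.ofInfinite 1 K (expGL Y)) : (AdeleRing (𝓞 K) K)ˣ) :
        AdeleRing (𝓞 K) K).1) w) =
      if hw : w.IsReal then ((Real.exp ((Y 0 0).1 ⟨w, hw⟩) : ℝ) : ℂ)
      else Complex.exp ((Y 0 0).2 ⟨w, not_isReal_iff_isComplex.1 hw⟩) := by
  by_cases hw : w.IsReal
  · rw [dif_pos hw]
    exact extensionEmbedding_det_ofInfinite_expGL_of_isReal K Y ⟨w, hw⟩
  · rw [dif_neg hw]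
    exact extensionEmbedding_det_ofInfinite_expGL_of_isComplex K Y ⟨w, not_isReal_iff_isComplex.1 hw⟩

/-- **Ideles with the same finite part and the same archimedean coordinates are equal** (the
embeddings `E_w → ℂ` are injective). [folklore] -/
theorem idele_eq_of_snd_eq_of_extensionEmbedding_eq {x y : (AdeleRing (𝓞 K) K)ˣ}
    (h2 : (x : AdeleRing (𝓞 K) K).2 = (y : AdeleRing (𝓞 K) K).2)
    (h1 : ∀ w : InfinitePlace K, Completion.extensionEmbedding w ((x : AdeleRing (𝓞 K) K).1 w) =
      Completion.extensionEmbedding w ((y : AdeleRing (𝓞 K) K).1 w)) : x = y :=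
  Units.ext (Prod.ext (funext fun w => (Completion.isometry_extensionEmbedding w).injective (h1 w)) h2)

omit [NumberField K] in
/-- The entry of the place matrix `a_w = complexPlaceLie 1 w (a · 1)`: `(0, single w a)`. [folklore] -/
theorem complexPlaceLie_smul_one_apply (w : {w : InfinitePlace K // w.IsComplex}) (a : ℂ) :
    complexPlaceLie 1 w (a • (1 : Matrix (Fin 1) (Fin 1) ℂ)) 0 0 = (0, Pi.single w a) := by
  rw [complexPlaceLie_apply, Matrix.smul_apply, Matrix.one_apply_eq, smul_eq_mul, mul_one]

omit [NumberField K] in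
/-- The entry of the place matrix `r · 1_w = realPlaceLie 1 w (r · 1)`: `(single w r, 0)`. [folklore] -/
theorem realPlaceLie_smul_one_apply (w : {w : InfinitePlace K // w.IsReal}) (r : ℝ) :
    realPlaceLie 1 w (r • (1 : Matrix (Fin 1) (Fin 1) ℝ)) 0 0 = (Pi.single w r, 0) := by
  rw [realPlaceLie_apply, Matrix.smul_apply, Matrix.one_apply_eq, smul_eq_mul, mul_one]

/-- Coordinates of `γ_K(a_w) = det (exp a_w, 1)` for a complex place `w`: `e^a` at `w`, `1`
elsewhere. [folklore] -/
theorem extensionEmbedding_det_ofInfinite_expGL_complexPlaceLie (w : {w : InfinitePlace K // w.IsComplex})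
    (a : ℂ) (w' : InfinitePlace K) :
    Completion.extensionEmbedding w'
      ((((Matrix.GeneralLinearGroup.det (GLn.ofInfinite 1 K
        (expGL (complexPlaceLie 1 w (a • (1 : Matrix (Fin 1) (Fin 1) ℂ))))) : (AdeleRing (𝓞 K) K)ˣ) :
          AdeleRing (𝓞 K) K).1) w') = if w' = w.1 then Complex.exp a else 1 := by
  rw [extensionEmbedding_det_ofInfinite_expGL, complexPlaceLie_smul_one_apply]
  by_cases hw' : w'.IsReal
  · have hne : w' ≠ w.1 := fun h => (not_isReal_iff_isComplex.2 w.2) (h ▸ hw')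
    rw [dif_pos hw', if_neg hne]
    simp
  · rw [dif_neg hw']
    by_cases h : w' = w.1
    · subst h
      simp
    · rw [if_neg h]
      have hne : (⟨w', not_isReal_iff_isComplex.1 hw'⟩ : {w : InfinitePlace K // w.IsComplex}) ≠ w :=
        fun h' => h (congrArg Subtype.val h')
      simp [hne]

/-- Coordinates of `γ_K(r · 1_w) = det (exp (r · 1_w), 1)` for a real place `w`: `e^r` at `w`, `1`
elsewhere. [folklore] -/
theorem extensionEmbedding_det_ofInfinite_expGL_realPlaceLie (w : {w : InfinitePlace K // w.IsReal})
    (r : ℝ) (w' : InfinitePlace K) :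
    Completion.extensionEmbedding w'
      ((((Matrix.GeneralLinearGroup.det (GLn.ofInfinite 1 K
        (expGL (realPlaceLie 1 w (r • (1 : Matrix (Fin 1) (Fin 1) ℝ))))) : (AdeleRing (𝓞 K) K)ˣ) :
          AdeleRing (𝓞 K) K).1) w') = if w' = w.1 then ((Real.exp r : ℝ) : ℂ) else 1 := by
  rw [extensionEmbedding_det_ofInfinite_expGL, realPlaceLie_smul_one_apply]
  by_cases hw' : w'.IsReal
  · rw [dif_pos hw']
    by_cases h : w' = w.1
    · subst h
      simp
    · rw [if_neg h]
      have hne : (⟨w', hw'⟩ : {w : InfinitePlace K // w.IsReal}) ≠ w := fun h' => h (congrArg Subtype.val h')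
      simp [hne]
  · have hne : w' ≠ w.1 := fun h => hw' (h ▸ w.2)
    rw [dif_neg hw', if_neg hne]
    simp

end Coordinates

/-! ### Galois action on the exponential ideles -/

section Galois

variable (F E : Type) [Field F] [Field E] [NumberField E] [Algebra F E]

/-- The finite part of `σ • det (exp Y, 1)` is `1`. [folklore] -/
theorem smul_det_ofInfinite_expGL_snd (σ : E ≃ₐ[F] E) (g : GL (Fin 1) (mixedSpace E)) :
    ((σ • (Matrix.GeneralLinearGroup.det (GLn.ofInfinite 1 E g)) : (AdeleRing (𝓞 E) E)ˣ) :
        AdeleRing (𝓞 E) E).2 = 1 := by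
  rw [AdeleRing.coe_smul_units, AdeleRing.smul_snd, det_ofInfinite_snd, smul_one]

/-- Coordinates of `σ • y` at `w`: those of `y` at `σ⁻¹ w`, or their conjugates. [folklore] -/
theorem extensionEmbedding_smul_fst_apply (σ : E ≃ₐ[F] E) (y : (AdeleRing (𝓞 E) E)ˣ) (w : InfinitePlace E) :
    Completion.extensionEmbedding w (((σ • y : (AdeleRing (𝓞 E) E)ˣ) : AdeleRing (𝓞 E) E).1 w) =
        Completion.extensionEmbedding (σ⁻¹ • w) ((y : AdeleRing (𝓞 E) E).1 (σ⁻¹ • w)) ∨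
      Completion.extensionEmbedding w (((σ • y : (AdeleRing (𝓞 E) E)ˣ) : AdeleRing (𝓞 E) E).1 w) =
        conj (Completion.extensionEmbedding (σ⁻¹ • w) ((y : AdeleRing (𝓞 E) E).1 (σ⁻¹ • w))) := by
  rw [AdeleRing.coe_smul_units, AdeleRing.smul_fst, InfiniteAdeleRing.smul_apply]
  rcases ArchHerbrand.extensionEmbedding_galInfiniteCompletionMap σ (smul_inv_smul σ w) with h | h
  · exact Or.inl (h _)
  · exact Or.inr (h _)

/-- **`σ • γ_E(r · 1_w) = γ_E(r · 1_{σ w})`** for a real place `w` of `E`: the exponential idele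
at a real place is carried to the exponential idele at the image place (its coordinates are real,
so the conjugation ambiguity of the transport disappears). [folklore] -/
theorem smul_det_ofInfinite_expGL_realPlace (σ : E ≃ₐ[F] E) (w : {w : InfinitePlace E // w.IsReal})
    (r : ℝ) :
    σ • Matrix.GeneralLinearGroup.det (GLn.ofInfinite 1 E
        (expGL (realPlaceLie 1 w (r • (1 : Matrix (Fin 1) (Fin 1) ℝ))))) =
      Matrix.GeneralLinearGroup.det (GLn.ofInfinite 1 E
        (expGL (realPlaceLie 1 ⟨σ • w.1, (isReal_smul_iff).2 w.2⟩ (r • (1 : Matrix (Fin 1) (Fin 1) ℝ))))) := by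
  refine idele_eq_of_snd_eq_of_extensionEmbedding_eq E ?_ fun w' => ?_
  · rw [smul_det_ofInfinite_expGL_snd, det_ofInfinite_snd]
  · rw [extensionEmbedding_det_ofInfinite_expGL_realPlaceLie]
    have key : Completion.extensionEmbedding (σ⁻¹ • w')
        ((((Matrix.GeneralLinearGroup.det (GLn.ofInfinite 1 E
          (expGL (realPlaceLie 1 w (r • (1 : Matrix (Fin 1) (Fin 1) ℝ))))) : (AdeleRing (𝓞 E) E)ˣ) :
            AdeleRing (𝓞 E) E).1) (σ⁻¹ • w')) = if w' = σ • w.1 then ((Real.exp r : ℝ) : ℂ) else 1 := by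
      rw [extensionEmbedding_det_ofInfinite_expGL_realPlaceLie]
      have hiff : σ⁻¹ • w' = w.1 ↔ w' = σ • w.1 := by
        constructor
        · intro h; rw [← h, smul_inv_smul]
        · intro h; rw [h, inv_smul_smul]
      by_cases h : w' = σ • w.1
      · rw [if_pos (hiff.2 h), if_pos h]
      · rw [if_neg (fun h' => h (hiff.1 h')), if_neg h]
    rcases extensionEmbedding_smul_fst_apply F E σ _ w' with h | h
    · rw [h, key]
    · rw [h, key]
      split_ifs
      · exact Complex.conj_ofReal _
      · exact map_one _

/-- **`σ • γ_E(a_w) = γ_E(a'_{σ w})` with `a' = a` or `a' = ā`** for a complex place `w` of `E`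
(`σ_w : E_w → E_{σ w}` followed by the embedding of `σ w` is the embedding of `w` or its
conjugate, `extensionEmbedding_galInfiniteCompletionMap`). [folklore] -/
theorem smul_det_ofInfinite_expGL_complexPlace (σ : E ≃ₐ[F] E) (w : {w : InfinitePlace E // w.IsComplex})
    (a : ℂ) :
    ∃ a' : ℂ, (a' = a ∨ a' = conj a) ∧
      σ • Matrix.GeneralLinearGroup.det (GLn.ofInfinite 1 E
          (expGL (complexPlaceLie 1 w (a • (1 : Matrix (Fin 1) (Fin 1) ℂ))))) =
        Matrix.GeneralLinearGroup.det (GLn.ofInfinite 1 E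
          (expGL (complexPlaceLie 1 ⟨σ • w.1, (isComplex_smul_iff).2 w.2⟩
            (a' • (1 : Matrix (Fin 1) (Fin 1) ℂ))))) := by
  -- which case of the transport at the place `σ w`
  have hcoord : ∀ (a' : ℂ) (w' : InfinitePlace E), Completion.extensionEmbedding (σ⁻¹ • w')
      ((((Matrix.GeneralLinearGroup.det (GLn.ofInfinite 1 E
        (expGL (complexPlaceLie 1 w (a' • (1 : Matrix (Fin 1) (Fin 1) ℂ))))) : (AdeleRing (𝓞 E) E)ˣ) :
          AdeleRing (𝓞 E) E).1) (σ⁻¹ • w')) = if w' = σ • w.1 then Complex.exp a' else 1 := by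
    intro a' w'
    rw [extensionEmbedding_det_ofInfinite_expGL_complexPlaceLie]
    have hiff : σ⁻¹ • w' = w.1 ↔ w' = σ • w.1 := by
      constructor
      · intro h; rw [← h, smul_inv_smul]
      · intro h; rw [h, inv_smul_smul]
    by_cases h : w' = σ • w.1
    · rw [if_pos (hiff.2 h), if_pos h]
    · rw [if_neg (fun h' => h (hiff.1 h')), if_neg h]
  rcases extensionEmbedding_smul_fst_apply F E σ
    (Matrix.GeneralLinearGroup.det (GLn.ofInfinite 1 E
      (expGL (complexPlaceLie 1 w (a • (1 : Matrix (Fin 1) (Fin 1) ℂ)))))) (σ • w.1) with hσ | hσ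
  · -- the embedding of `σ w` after `σ_w` is the embedding of `w`: `a' = a`
    refine ⟨a, Or.inl rfl, idele_eq_of_snd_eq_of_extensionEmbedding_eq E ?_ fun w' => ?_⟩
    · rw [smul_det_ofInfinite_expGL_snd, det_ofInfinite_snd]
    · rw [extensionEmbedding_det_ofInfinite_expGL_complexPlaceLie]
      dsimp only
      by_cases h : w' = σ • w.1
      · subst h
        rw [hσ, hcoord]
      · rcases extensionEmbedding_smul_fst_apply F E σ _ w' with h' | h'
        · rw [h', hcoord, if_neg h]
        · rw [h', hcoord, if_neg h, map_one]
  · -- the conjugate case: `a' = ā`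
    refine ⟨conj a, Or.inr rfl, idele_eq_of_snd_eq_of_extensionEmbedding_eq E ?_ fun w' => ?_⟩
    · rw [smul_det_ofInfinite_expGL_snd, det_ofInfinite_snd]
    · rw [extensionEmbedding_det_ofInfinite_expGL_complexPlaceLie]
      dsimp only
      by_cases h : w' = σ • w.1
      · subst h
        rw [hσ, hcoord, if_pos rfl, ← Complex.exp_conj, if_pos rfl]
      · rcases extensionEmbedding_smul_fst_apply F E σ _ w' with h' | h'
        · rw [h', hcoord, if_neg h, if_neg h]
        · rw [h', hcoord, if_neg h, map_one, if_neg h]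

/-- **The non-trivial element of the decomposition group of a complex place acts on its
exponential ideles by conjugation**: for `c • w = w`, `c ≠ 1`, `c • γ_E(a_w) = γ_E(ā_w)`
(`extensionEmbedding_galInfiniteCompletionMap_of_ne_one`). Tate (1967), Ch. VII §1.1; Childress
(2009), Prop. 5.7 (ii). [cite: CasselsFrohlichANT1967, Ch. VII §1.1] -/
theorem smul_det_ofInfinite_expGL_complexPlace_of_ne_one {c : E ≃ₐ[F] E}
    (w : {w : InfinitePlace E // w.IsComplex}) (hc : c • w.1 = w.1) (hc1 : c ≠ 1) (a : ℂ) :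
    c • Matrix.GeneralLinearGroup.det (GLn.ofInfinite 1 E
        (expGL (complexPlaceLie 1 w (a • (1 : Matrix (Fin 1) (Fin 1) ℂ))))) =
      Matrix.GeneralLinearGroup.det (GLn.ofInfinite 1 E
        (expGL (complexPlaceLie 1 w (conj a • (1 : Matrix (Fin 1) (Fin 1) ℂ))))) := by
  have hcinv : c⁻¹ • w.1 = w.1 := by
    conv_lhs => rw [← hc, inv_smul_smul]
  refine idele_eq_of_snd_eq_of_extensionEmbedding_eq E ?_ fun w' => ?_
  · rw [smul_det_ofInfinite_expGL_snd, det_ofInfinite_snd]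
  · rw [extensionEmbedding_det_ofInfinite_expGL_complexPlaceLie, AdeleRing.coe_smul_units,
      AdeleRing.smul_fst, InfiniteAdeleRing.smul_apply]
    by_cases h : w' = w.1
    · subst h
      rw [if_pos rfl]
      have key := ArchHerbrand.extensionEmbedding_galInfiniteCompletionMap_of_ne_one (F := F)
        (σ := c) (w := w.1) hc hc1
      -- transport along the equality of places `c⁻¹ • w = w`
      have h1 : Completion.extensionEmbedding w.1
          (galInfiniteCompletionMap c (smul_inv_smul c w.1)
            ((((Matrix.GeneralLinearGroup.det (GLn.ofInfinite 1 E
              (expGL (complexPlaceLie 1 w (a • (1 : Matrix (Fin 1) (Fin 1) ℂ))))) : (AdeleRing (𝓞 E) E)ˣ) :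
                AdeleRing (𝓞 E) E).1) (c⁻¹ • w.1))) =
          conj (Completion.extensionEmbedding (c⁻¹ • w.1)
            ((((Matrix.GeneralLinearGroup.det (GLn.ofInfinite 1 E
              (expGL (complexPlaceLie 1 w (a • (1 : Matrix (Fin 1) (Fin 1) ℂ))))) : (AdeleRing (𝓞 E) E)ˣ) :
                AdeleRing (𝓞 E) E).1) (c⁻¹ • w.1))) := by
        rcases ArchHerbrand.extensionEmbedding_galInfiniteCompletionMap c (smul_inv_smul c w.1) with h' | h'
        · exfalso
          apply hc1
          -- if the transport were the identity on coordinates, `c` would fix `E`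
          ext x
          have := h' ((x : E) : (c⁻¹ • w.1).Completion)
          rw [galInfiniteCompletionMap_coe, ArchHerbrand.extensionEmbedding_coe',
            ArchHerbrand.extensionEmbedding_coe'] at this
          rw [hcinv] at this
          exact w.1.embedding.injective this
        · exact h' _
      rw [h1, extensionEmbedding_det_ofInfinite_expGL_complexPlaceLie, if_pos hcinv, Complex.exp_conj]
    · rw [if_neg h]
      have hne : c⁻¹ • w' ≠ w.1 := fun h' => h (by rw [← smul_inv_smul c w', h', hc])
      rcases ArchHerbrand.extensionEmbedding_galInfiniteCompletionMap c (smul_inv_smul c w') with h' | h'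
      · rw [h', extensionEmbedding_det_ofInfinite_expGL_complexPlaceLie, if_neg hne]
      · rw [h', extensionEmbedding_det_ofInfinite_expGL_complexPlaceLie, if_neg hne, map_one]

end Galois

/-! ### Base change of the exponential ideles -/

section BaseChange

variable (F E : Type) [Field F] [NumberField F] [Field E] [NumberField E] [Algebra F E]

omit [NumberField F] [NumberField E] in
/-- The two complex embeddings defining `w` and `w|_F`: `σ_w ∘ (F → E)` is `σ_{w|_F}` or its
conjugate. [folklore] -/
theorem embedding_comp_eq_or (w : InfinitePlace E) :
    w.embedding.comp (algebraMap F E) = (w.comap (algebraMap F E)).embedding ∨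
      ComplexEmbedding.conjugate (w.embedding.comp (algebraMap F E)) =
        (w.comap (algebraMap F E)).embedding := by
  refine mk_eq_iff.1 ?_
  rw [← comap_mk, mk_embedding, mk_embedding]

omit [NumberField F] [NumberField E] in
/-- **Coordinates of `F_v → E_w`** (`v = w|_F`), first case: if `σ_w` extends `σ_v` then so do the
embeddings of the completions (Mathlib `liesOver_extensionEmbedding`). [folklore] -/
theorem extensionEmbedding_infiniteCompletionOfComap_of_eq (w : InfinitePlace E)
    (h : w.embedding.comp (algebraMap F E) = (w.comap (algebraMap F E)).embedding)
    (z : (w.comap (algebraMap F E)).Completion) :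
    Completion.extensionEmbedding w (infiniteCompletionOfComap F E w z) =
      Completion.extensionEmbedding (w.comap (algebraMap F E)) z := by
  open scoped NumberField.LiesOver in
  haveI iw : w.1.LiesOver (w.comap (algebraMap F E)).1 := ⟨rfl⟩
  haveI : ComplexEmbedding.LiesOver w.embedding (w.comap (algebraMap F E)).embedding := ⟨h⟩
  haveI := Completion.liesOver_extensionEmbedding w
    (w.comap (algebraMap F E))
  exact Completion.liesOver_extensionEmbedding_apply w
    (w.comap (algebraMap F E)) (φ := Completion.extensionEmbedding w) (x := z)

omit [NumberField F] [NumberField E] in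
/-- **Coordinates of `F_v → E_w`**, second case: otherwise the embedding of `E_w` composed with
`F_v → E_w` is the conjugate of the embedding of `F_v` (Mathlib
`liesOver_conjugate_extensionEmbedding`). [folklore] -/
theorem extensionEmbedding_infiniteCompletionOfComap_of_ne (w : InfinitePlace E)
    (h : w.embedding.comp (algebraMap F E) ≠ (w.comap (algebraMap F E)).embedding)
    (z : (w.comap (algebraMap F E)).Completion) :
    Completion.extensionEmbedding w (infiniteCompletionOfComap F E w z) =
      conj (Completion.extensionEmbedding (w.comap (algebraMap F E)) z) := by
  open scoped NumberField.LiesOver in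
  haveI iw : w.1.LiesOver (w.comap (algebraMap F E)).1 := ⟨rfl⟩
  have hconj : ComplexEmbedding.conjugate (w.embedding.comp (algebraMap F E)) =
      (w.comap (algebraMap F E)).embedding := (embedding_comp_eq_or F E w).resolve_left h
  haveI : ComplexEmbedding.LiesOver (ComplexEmbedding.conjugate w.embedding)
      (w.comap (algebraMap F E)).embedding := ⟨by rw [ComplexEmbedding.conjugate_comp, hconj]⟩
  haveI := Completion.liesOver_conjugate_extensionEmbedding w
    (w.comap (algebraMap F E))
  have key := Completion.liesOver_extensionEmbedding_apply w
    (w.comap (algebraMap F E)) (φ := ComplexEmbedding.conjugate (Completion.extensionEmbedding w))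
    (x := z)
  rw [ComplexEmbedding.conjugate_coe_eq] at key
  rw [← key, Complex.conj_conj]
  rfl

/-- The finite part of the base change of `det (exp Y, 1)` is `1`. [folklore] -/
theorem ideleBaseChange_det_ofInfinite_snd (g : GL (Fin 1) (mixedSpace F)) :
    ((AdeleRing.ideleBaseChange F E (Matrix.GeneralLinearGroup.det (GLn.ofInfinite 1 F g)) :
      (AdeleRing (𝓞 E) E)ˣ) : AdeleRing (𝓞 E) E).2 = 1 := by
  rw [AdeleRing.coe_ideleBaseChange, AdeleRing.baseChange_snd, det_ofInfinite_snd, map_one]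

/-- Coordinates of the base change of an idele at an infinite place `w`: those of the idele at
`w|_F`, or their conjugates. [folklore] -/
theorem extensionEmbedding_ideleBaseChange_fst_apply (x : (AdeleRing (𝓞 F) F)ˣ) (w : InfinitePlace E) :
    Completion.extensionEmbedding w
        (((AdeleRing.ideleBaseChange F E x : (AdeleRing (𝓞 E) E)ˣ) : AdeleRing (𝓞 E) E).1 w) =
      if w.embedding.comp (algebraMap F E) = (w.comap (algebraMap F E)).embedding then
        Completion.extensionEmbedding (w.comap (algebraMap F E))
          ((x : AdeleRing (𝓞 F) F).1 (w.comap (algebraMap F E)))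
      else conj (Completion.extensionEmbedding (w.comap (algebraMap F E))
          ((x : AdeleRing (𝓞 F) F).1 (w.comap (algebraMap F E)))) := by
  rw [AdeleRing.coe_ideleBaseChange, AdeleRing.baseChange_fst, InfiniteAdeleRing.baseChange_apply]
  split_ifs with h
  · exact extensionEmbedding_infiniteCompletionOfComap_of_eq F E w h _
  · exact extensionEmbedding_infiniteCompletionOfComap_of_ne F E w h _

/-- The entry of `y · 1`. [folklore] -/
theorem smul_one_matrix_apply {R : Type*} [Semiring R] (y : R) :
    (y • (1 : Matrix (Fin 1) (Fin 1) R)) 0 0 = y := by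
  rw [Matrix.smul_apply, Matrix.one_apply_eq, smul_eq_mul, mul_one]

/-- **Base change of `γ_F(r · 1_v)` at a real place `v` of `F`**: it is `γ_E(y · 1)` where
`y ∈ E_∞` is `r` at every place `w ∣ v` (real or complex) and `0` elsewhere:
`(x_v)_E = (x_v, …, x_v)` at the places above `v`. Cassels (1967), Ch. II §14; Tate (1967),
Ch. VII §1.1. [cite: CasselsFrohlichANT1967, Ch. II §14] -/
theorem ideleBaseChange_det_ofInfinite_expGL_realPlace (v : {v : InfinitePlace F // v.IsReal}) (r : ℝ) :
    AdeleRing.ideleBaseChange F E (Matrix.GeneralLinearGroup.det (GLn.ofInfinite 1 F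
        (expGL (realPlaceLie 1 v (r • (1 : Matrix (Fin 1) (Fin 1) ℝ)))))) =
      Matrix.GeneralLinearGroup.det (GLn.ofInfinite 1 E (expGL
        (((fun w : {w : InfinitePlace E // w.IsReal} =>
            if w.1.comap (algebraMap F E) = v.1 then r else 0,
          fun w : {w : InfinitePlace E // w.IsComplex} =>
            if w.1.comap (algebraMap F E) = v.1 then (r : ℂ) else 0) : mixedSpace E) •
          (1 : Matrix (Fin 1) (Fin 1) (mixedSpace E))))) := by
  refine idele_eq_of_snd_eq_of_extensionEmbedding_eq E ?_ fun w => ?_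
  · rw [ideleBaseChange_det_ofInfinite_snd, det_ofInfinite_snd]
  · -- coordinates of the base change at `w`: `e^r` if `w ∣ v`, `1` otherwise (real, so no conjugation)
    have hF : Completion.extensionEmbedding (w.comap (algebraMap F E))
        ((((Matrix.GeneralLinearGroup.det (GLn.ofInfinite 1 F
          (expGL (realPlaceLie 1 v (r • (1 : Matrix (Fin 1) (Fin 1) ℝ))))) : (AdeleRing (𝓞 F) F)ˣ) :
            AdeleRing (𝓞 F) F).1) (w.comap (algebraMap F E))) =
          if w.comap (algebraMap F E) = v.1 then ((Real.exp r : ℝ) : ℂ) else 1 :=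
      extensionEmbedding_det_ofInfinite_expGL_realPlaceLie F v r _
    have hlhs : Completion.extensionEmbedding w
        (((AdeleRing.ideleBaseChange F E (Matrix.GeneralLinearGroup.det (GLn.ofInfinite 1 F
          (expGL (realPlaceLie 1 v (r • (1 : Matrix (Fin 1) (Fin 1) ℝ)))))) : (AdeleRing (𝓞 E) E)ˣ) :
            AdeleRing (𝓞 E) E).1 w) =
          if w.comap (algebraMap F E) = v.1 then ((Real.exp r : ℝ) : ℂ) else 1 := by
      rw [extensionEmbedding_ideleBaseChange_fst_apply, hF]
      split_ifs
      · rfl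
      · rfl
      · exact Complex.conj_ofReal _
      · exact map_one _
    rw [hlhs, extensionEmbedding_det_ofInfinite_expGL, smul_one_matrix_apply]
    by_cases hw : w.IsReal
    · rw [dif_pos hw]
      dsimp only
      split_ifs
      · rfl
      · rw [Real.exp_zero, Complex.ofReal_one]
    · rw [dif_neg hw]
      dsimp only
      split_ifs
      · exact Complex.ofReal_exp r
      · rw [Complex.exp_zero]

/-- **Base change of `γ_F(b_v)` at a complex place `v` of `F`**: it is `γ_E(y · 1)` where
`y ∈ E_∞` is, at a place `w ∣ v` (necessarily complex), `b` if `σ_w` extends `σ_v` and `b̄`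
otherwise, and `0` elsewhere. Cassels (1967), Ch. II §14; Tate (1967), Ch. VII §1.1.
[cite: CasselsFrohlichANT1967, Ch. II §14] -/
theorem ideleBaseChange_det_ofInfinite_expGL_complexPlace (v : {v : InfinitePlace F // v.IsComplex}) (b : ℂ) :
    AdeleRing.ideleBaseChange F E (Matrix.GeneralLinearGroup.det (GLn.ofInfinite 1 F
        (expGL (complexPlaceLie 1 v (b • (1 : Matrix (Fin 1) (Fin 1) ℂ)))))) =
      Matrix.GeneralLinearGroup.det (GLn.ofInfinite 1 E (expGL
        (((fun _ : {w : InfinitePlace E // w.IsReal} => (0 : ℝ),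
          fun w : {w : InfinitePlace E // w.IsComplex} =>
            if w.1.comap (algebraMap F E) = v.1 then
              (if w.1.embedding.comp (algebraMap F E) = v.1.embedding then b else conj b)
            else 0) : mixedSpace E) •
          (1 : Matrix (Fin 1) (Fin 1) (mixedSpace E))))) := by
  refine idele_eq_of_snd_eq_of_extensionEmbedding_eq E ?_ fun w => ?_
  · rw [ideleBaseChange_det_ofInfinite_snd, det_ofInfinite_snd]
  · have hF : Completion.extensionEmbedding (w.comap (algebraMap F E))
        ((((Matrix.GeneralLinearGroup.det (GLn.ofInfinite 1 F
          (expGL (complexPlaceLie 1 v (b • (1 : Matrix (Fin 1) (Fin 1) ℂ))))) : (AdeleRing (𝓞 F) F)ˣ) :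
            AdeleRing (𝓞 F) F).1) (w.comap (algebraMap F E))) =
          if w.comap (algebraMap F E) = v.1 then Complex.exp b else 1 :=
      extensionEmbedding_det_ofInfinite_expGL_complexPlaceLie F v b _
    rw [extensionEmbedding_ideleBaseChange_fst_apply, hF, extensionEmbedding_det_ofInfinite_expGL,
      smul_one_matrix_apply]
    by_cases hw : w.IsReal
    · -- a real `w` cannot lie over the complex `v`
      have hne : w.comap (algebraMap F E) ≠ v.1 := fun h =>
        (not_isReal_iff_isComplex.2 v.2) (h ▸ hw.comap (algebraMap F E))
      rw [dif_pos hw, if_neg hne]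
      dsimp only
      rw [Real.exp_zero, Complex.ofReal_one]
      split_ifs
      · rfl
      · exact map_one _
    · rw [dif_neg hw]
      dsimp only
      by_cases hover : w.comap (algebraMap F E) = v.1
      · rw [if_pos hover, if_pos hover]
        by_cases hemb : w.embedding.comp (algebraMap F E) = v.1.embedding
        · rw [if_pos (hover ▸ hemb), if_pos hemb]
        · have hemb' : ¬ w.embedding.comp (algebraMap F E) = (w.comap (algebraMap F E)).embedding := by
            rw [hover]; exact hemb
          rw [if_neg hemb', if_neg hemb, Complex.exp_conj]
      · rw [if_neg hover, if_neg hover, Complex.exp_zero]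
        split_ifs
        · rfl
        · exact map_one _

end BaseChange

end Literature.NumberTheory.Automorphic
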